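import Mathlib
import Summits.MatrixMultiplication.MatrixMultiplication.Theorems.LieRankDesigns.Negative.Basics
import Summits.MatrixMultiplication.MatrixMultiplication.Theorems.LevelGradedCohnUmansLieRankDesignsStubFrameFnLevel

/-!
# `LieRankDesigns` (stmt-MatrixMultiplication-7614), line `Sketch`: private-token designs are rank-one separated (every rank `m`)

Lead seat prover-line-stmt-MatrixMultiplication-7614-c3; lands `--supports stmt-MatrixMultiplication-7614` as the
constructive half of the level-one cells `(m, 1)` of the open design stub G'' `stub_nearWallDesigns`.

**Private tokens.**  `G = GL_m(𝔽_p)` acts on column vectors.  Say a triple `X, Y, Z ⊆ G` has PRIVATE TOKENS if for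
every target `(x₀, z₀) ∈ X × Z` there is a vector `v` such that the based quadruple products move `v` to where the
target moves it only in the trivial case:

  `x⁻¹ y y'⁻¹ z · v = x₀⁻¹ z₀ · v  ⟹  x = x₀ ∧ y = y' ∧ z = z₀`   (`x ∈ X`, `y, y' ∈ Y`, `z ∈ Z`).

Then the indicator `g ↦ 1[g v = x₀⁻¹ z₀ v]` separates the target, and it is a LEVEL-ONE test function for every `m`:
it is the `1`-frame function `g ↦ Σ_U φ(U, g U)` with `φ(U, W) = [U = v]·[W = x₀⁻¹z₀ v]` (`U, W ∈ M_{m×1}(𝔽_p)`),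
which lies in `F_1` by the landed frame duality `stub_frameFnLevel` (stub K, p93384).  Hence
(`stub_rankSepOfPrivateTokens`, registered stub) **private-token designs are `RankSep 1`** — the rank-`m` form of the sibling crux's
`LevelOneGL2Designs.FlagLine.stub_rankSep_of_singleLine` (`m = 2`, p89629), which is the one constructive separation
mechanism on record for the Lie cells.  Consequently a private-token family at a cell `(m, 1)` with
`|X||Y||Z| ≥ p^{3m − 3/2 − δ}` along unboundedly many primes, for every `δ > 0`, proves the crux through the landed
transfer `stub_nearWallTransfer` (p116933); `nearWallDesigns_levelOne_of_privateTokens` records this reduction in the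
exact shape of G'''s `(m,1)` slice.

Necessary counts for such a family (paper, recorded for the planners; not formalised here): the tokens
`(𝔽_p v, x₀⁻¹z₀ v)` of distinct targets are distinct, so `|X||Z| ≤ (p^m − 1)²/(p − 1) + …` is the level-one wall again,
and a direction `v` shared by the targets of `X_v × Z` forces `(x₀, z₀) ↦ x₀⁻¹ z₀ v` injective on `X_v × Z`, i.e.
`|X_v| ≤ p^m/|Z| ≈ p^{1/2}` at the wall: the directions must spread over `≈ p^{m−1}` lines.
-/

set_option linter.dupNamespace false

noncomputable section

open scoped BigOperators
open Literature.RepresentationTheory.FiniteGroups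
open Summit.MatrixMultiplication.MatrixMultiplication.Theorems.LieRankDesigns.Negative
  (GLm Mat fourierFn RankSupp RankSep levelSet budget volume)

namespace Summit.MatrixMultiplication.MatrixMultiplication.Theorems.LieRankDesigns

namespace PrivateToken

variable {p m : ℕ} [Fact p.Prime]

/-- The column matrix of a vector (`M_{m×1}`). -/
theorem mul_colOf_apply (g : Mat p m) (v : Fin m → ZMod p) (i : Fin m) (j : Fin 1) :
    (g * (Matrix.of fun a (_ : Fin 1) => v a)) i j = g.mulVec v i := by
  simp [Matrix.mul_apply, Matrix.mulVec, dotProduct]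

/-- `g · col(v) = col(w)` iff `g v = w`. -/
theorem mul_colOf_eq_iff (g : Mat p m) (v w : Fin m → ZMod p) :
    g * (Matrix.of fun a (_ : Fin 1) => v a) = (Matrix.of fun a (_ : Fin 1) => w a) ↔ g.mulVec v = w := by
  constructor
  · intro h
    funext i
    have := congrFun (congrFun h i) 0
    rwa [mul_colOf_apply, Matrix.of_apply] at this
  · intro h
    ext i j
    rw [mul_colOf_apply, Matrix.of_apply, h]

/-- **The single-token indicator is a level-one test function** (every rank `m`): for vectors `v, w` there is a
rank-`≤ 1`-supported Fourier table `c` with `fourierFn c g = 1[g v = w]` on `GL_m(𝔽_p)` — the `1`-frame function with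
kernel `φ(U, W) = [U = col v][W = col w]`, in `F_1` by `stub_frameFnLevel`. -/
theorem exists_tokenCoeff (v w : Fin m → ZMod p) :
    ∃ c : Mat p m → ℂ, RankSupp 1 c ∧
      ∀ g : GLm p m, fourierFn c g = if (g : Mat p m).mulVec v = w then 1 else 0 := by
  classical
  set U₀ : Matrix (Fin m) (Fin 1) (ZMod p) := Matrix.of fun a (_ : Fin 1) => v a with hU₀
  set W₀ : Matrix (Fin m) (Fin 1) (ZMod p) := Matrix.of fun a (_ : Fin 1) => w a with hW₀
  set φ : Matrix (Fin m) (Fin 1) (ZMod p) → Matrix (Fin m) (Fin 1) (ZMod p) → ℂ :=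
    fun U W => if U = U₀ ∧ W = W₀ then 1 else 0 with hφ
  obtain ⟨c, hc, hcf⟩ := stub_frameFnLevel p m 1 φ
  refine ⟨c, hc, fun g => ?_⟩
  rw [← hcf g]
  -- the frame sum collapses to the single frame `U₀`
  have hsum : (∑ U : Matrix (Fin m) (Fin 1) (ZMod p), φ U ((g : Mat p m) * U)) = φ U₀ ((g : Mat p m) * U₀) :=
    Finset.sum_eq_single U₀ (fun U _ hU => by simp [hφ, hU]) (fun h => (h (Finset.mem_univ _)).elim)
  have key : ((g : Mat p m) * U₀ = W₀) ↔ (g : Mat p m).mulVec v = w := mul_colOf_eq_iff _ v w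
  show (∑ U : Matrix (Fin m) (Fin 1) (ZMod p), φ U ((g : Mat p m) * U)) = _
  rw [hsum]
  simp only [hφ, true_and]
  by_cases hg : (g : Mat p m).mulVec v = w
  · rw [if_pos hg, if_pos (key.2 hg)]
  · rw [if_neg hg, if_neg fun h => hg (key.1 h)]

end PrivateToken

open PrivateToken

/-- **Private-token designs are rank-one separated** (every rank `m`; registered stub
`stub_rankSepOfPrivateTokens`).  If for every target `(x₀, z₀)` some vector `v` is moved to `x₀⁻¹ z₀ v` by a based
quadruple product `x⁻¹ y y'⁻¹ z` only in the trivial case, then `RankSep 1 X Y Z`: the separator is the single-token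
indicator `1[g v = x₀⁻¹ z₀ v] ∈ F_1`. -/
theorem stub_rankSepOfPrivateTokens :
    ∀ (p m : ℕ) [Fact p.Prime] (X Y Z : Finset (GLm p m)),
      (∀ x₀ ∈ X, ∀ z₀ ∈ Z, ∃ v : Fin m → ZMod p, ∀ x ∈ X, ∀ y ∈ Y, ∀ y' ∈ Y, ∀ z ∈ Z,
        ((x⁻¹ * y * y'⁻¹ * z : GLm p m) : Mat p m).mulVec v = ((x₀⁻¹ * z₀ : GLm p m) : Mat p m).mulVec v →
          x = x₀ ∧ y = y' ∧ z = z₀) →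
      RankSep 1 X Y Z := by
  intro p m _ X Y Z h x₀ hx₀ z₀ hz₀
  obtain ⟨v, hsep⟩ := h x₀ hx₀ z₀ hz₀
  obtain ⟨c, hc, hcf⟩ := exists_tokenCoeff v (((x₀⁻¹ * z₀ : GLm p m) : Mat p m).mulVec v)
  refine ⟨c, hc, fun x hx y hy y' hy' z hz => ?_⟩
  rw [hcf]
  by_cases hq : x = x₀ ∧ y = y' ∧ z = z₀
  · rw [if_pos hq]
    obtain ⟨hxx, hyy, hzz⟩ := hq
    rw [hxx, hyy, hzz, mul_inv_cancel_right, if_pos rfl]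
  · rw [if_neg hq, if_neg fun hgv => hq (hsep x hx y hy y' hy' z hz hgv)]

/-- **Reduction of G'' at the level-one cells to private-token packings.**  If for every loss `δ > 0` some rank
`m ≥ 1` carries, along unboundedly many primes, private-token triples of volume `≥ p^{3m − 3/2 − δ}`, then the
`(m, 1)` slice of `NearWallDesigns` holds (in the exact shape of the registered stub `stub_nearWallDesigns`, with
`k = 1`), hence the crux by `stub_nearWallTransfer` (p116933). -/
theorem nearWallDesigns_levelOne_of_privateTokens
    (hPT : ∀ δ : ℝ, 0 < δ → ∃ m : ℕ, 1 ≤ m ∧ ∀ p₀ : ℕ, ∃ (p : ℕ) (_ : Fact p.Prime), p₀ ≤ p ∧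
      ∃ X Y Z : Finset (GLm p m),
        (∀ x₀ ∈ X, ∀ z₀ ∈ Z, ∃ v : Fin m → ZMod p,
          ∀ x ∈ X, ∀ y ∈ Y, ∀ y' ∈ Y, ∀ z ∈ Z,
            ((x⁻¹ * y * y'⁻¹ * z : GLm p m) : Mat p m).mulVec v
              = ((x₀⁻¹ * z₀ : GLm p m) : Mat p m).mulVec v → x = x₀ ∧ y = y' ∧ z = z₀) ∧
        (p : ℝ) ^ (3 * (m : ℝ) * 1 - 3 / 2 * (1 : ℝ) ^ 2 - δ) ≤ volume X Y Z) :
    ∀ δ : ℝ, 0 < δ → ∃ m k : ℕ, 1 ≤ k ∧ k ≤ m ∧ ∀ p₀ : ℕ, ∃ (p : ℕ) (_ : Fact p.Prime), p₀ ≤ p ∧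
      ∃ X Y Z : Finset (GLm p m), RankSep k X Y Z ∧
        (p : ℝ) ^ (3 * (m : ℝ) * k - 3 / 2 * (k : ℝ) ^ 2 - δ) ≤ volume X Y Z := by
  intro δ hδ
  obtain ⟨m, hm, hall⟩ := hPT δ hδ
  refine ⟨m, 1, le_rfl, hm, fun p₀ => ?_⟩
  obtain ⟨p, hp, hp₀, X, Y, Z, hX, hvol⟩ := hall p₀
  refine ⟨p, hp, hp₀, X, Y, Z, stub_rankSepOfPrivateTokens p m X Y Z hX, ?_⟩
  simpa using hvol

end Summit.MatrixMultiplication.MatrixMultiplication.Theorems.LieRankDesigns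

end
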